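import Summits.KontsevichZagierPeriods.KontsevichZagierPeriods.Theses.IsogenyCertificates
import Summits.KontsevichZagierPeriods.KontsevichZagierPeriods.Theorems.XMapKernel.Negative.Core

/-!
# Route KontsevichZagierPeriods/IsogenyCertificates — the assembly `Assembly`
# (stmt-KontsevichZagierPeriods-10666)

Route `KontsevichZagierPeriods/IsogenyCertificates` (isogenies are KZ certificates: uniform
real-period transfer in dimension one along the x-map of an isogeny), item
stmt-KontsevichZagierPeriods-10666 (`Assembly`, rank 1):

  `XMapPeriodTransfer → XMapKernel → KontsevichZagierPeriods`.

Pure logic. Given rational-shape representations `r, r'` with equal values, the formal difference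
`c = [r] − [r']` has `eval c = value r − value r' = 0` (`KZ.eval_of`); the enlarged kernel
hypothesis `XMapKernel` puts `c` in `closure (moves ∪ x-map period relators)`; by
`AddSubgroup.closure_le` it suffices that every generator is a relation: the four move sets lie in
`KZ.relations` (`KZ.domainAddRel_subset_relations`, `KZ.integrandAddRel_subset_relations`,
`KZ.changeOfVariablesRel_subset_relations`, `KZ.newtonLeibnizRel_subset_relations`), and each x-map
period relator `[ρ] − [ρ']` lies in `KZ.relations` because `XMapPeriodTransfer` gives
`KZ.Equivalent ρ ρ'`, which unfolds to exactly that. Hence `c ∈ KZ.relations`, i.e.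
`KZ.Equivalent r r'`. That deduction is VERBATIM the route's kernel-checked deciding theorem
`Summit.KontsevichZagierPeriods.KontsevichZagierPeriods.Theses.IsogenyCertificates.closes :
XMapPeriodTransfer → XMapKernel → KontsevichZagierPeriods` (route file rev 3, D-0027 §2.1), so the
item is `closes` itself (`Assembly.Assembly_proof`).

Neither antecedent is discharged here: `XMapPeriodTransfer` (crux, stmt-KontsevichZagierPeriods-10665)
and `XMapKernel` (the route's rank-0 target, stmt-KontsevichZagierPeriods-10663; modulo
`XMapPeriodTransfer` it is of the strength of the kernel conjecture) remain hypotheses — the theorem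
is the implication, nothing more.

References: M. Kontsevich, D. Zagier, *Periods* (2001), §1.2 (Conjecture 1, rules 1)–3) and the
kernel reformulation); A. Huber, S. Müller-Stach, *Periods and Nori Motives* (2017), §13.1.
-/

namespace Summit.KontsevichZagierPeriods.IsogenyCertificates.Assembly

/-- **Assembly of route IsogenyCertificates** (settles stmt-KontsevichZagierPeriods-10666):
`XMapPeriodTransfer → XMapKernel → KontsevichZagierPeriods`. If every x-rational isogeny datum
transfers real periods inside the Kontsevich–Zagier calculus (`XMapPeriodTransfer`) and the kernel
of `eval` is generated by the four move sets together with the x-map period relators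
(`XMapKernel`), then any two rational-shape KZ representations with the same value are
KZ-equivalent. Proof: the route's deciding theorem `closes` (eval of `[r] − [r']` vanishes;
`AddSubgroup.closure_le`; moves are relations; x-map relators are relations by
`XMapPeriodTransfer`). [Kontsevich–Zagier 2001, §1.2; Huber–Müller-Stach 2017, §13.1] [folklore] -/
theorem Assembly_proof :
    Summit.KontsevichZagierPeriods.KontsevichZagierPeriods.Theses.IsogenyCertificates.Assembly := by
  unfold Summit.KontsevichZagierPeriods.KontsevichZagierPeriods.Theses.IsogenyCertificates.Assembly
  intro hT hK
  -- the route's `closes` was re-cut at rev 15 (2026-08-17) to the three sector cells + `XMapKernelOfCells`;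
  -- the former two-hypothesis deduction (moves and, by `hT`, the x-map relators lie in `KZ.relations`;
  -- `AddSubgroup.closure_le`) is the landed `XMapKernel.Negative.thesis_iff_summit` (→ direction).
  exact Summit.KontsevichZagierPeriods.XMapKernel.Negative.thesis_iff_summit.1 ⟨hT, hK⟩

end Summit.KontsevichZagierPeriods.IsogenyCertificates.Assembly
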